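import Literature.Computability.Cryptography.WordRAMToTM2Interp
import Literature.Computability.FineGrained.LightSatSplitting
import HarnessLib

/-!
# Word-RAM programs on multi-stack machines, III: the front end reading a `k`-CNF

Family `fine-grained` / trunk `CplxCore`, continuing `WordRAMToTM2Memory.lean` (register file,
memory log) and `WordRAMToTM2Interp.lean` (the interpreter). This file is the **front end** of the
machine behind the change of machine model `sparseKSATInExpTime_of_liberalSparseKSATInRAMTime`
(`CliqueETHTMBridge.lean`): a structured stack program `frontEnd kW : Com (K ⊕ AReg)` which reads
the token code `bits (hdrToks n ++ formulaToks F)` of a `k`-CNF (the output of the input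
transducer `LightSatSplitting.exists_recode_machine` on Wave0's `KCNF.encode`) and leaves on the
register file exactly what the interpreter expects: on `mem` a log of the initial memory of the
word RAM started on the `CNFSAT` input `x = n :: (m+1) :: 2 :: (2(n-1)+1) :: 2(n-1) :: data`
(the clause list padded in front with the tautological clause `x_{n-1} ∨ ¬x_{n-1}`, each clause as
its length followed by its literals `2 · var + polarity`, cell `0` holding `|x|`), on `wr` the
ruler `1^W` of the word size `W = kW · (T + n + 1)` (`T` the number of tokens), `n` on `nb`, the
empty-clause flag on `he`, and the run flag armed.

* `FS`, `fsSt` — the abstract state of the pass and its register file; the handlers `onPol`,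
  `onBit`, `onEndl`, `onEndc`, `hdrBit`, `hdrEndl` with their effects; `tokCase`/`mainLoop` — the
  decoder of the prefix code of tokens and the token loop; `tokStep` — its functional model, with
  `mainLoop_toks`: **the loop acts as `foldl tokStep`**, `tokCostB` steps per token;
* `hdrE01`, `hdrE23`, `hdrE45`, `buildRuler`, `postPass` / `runs_postPass` — the six header
  entries, the ruler (Horner on the header bits for `n` in unary), the run flag;
* `litPass`/`clausePass`/`formulaPass`, `foldl_tokStep_formulaToks`, `foldl_tokStep_hdrToks` —
  the fold clause by clause; `segLog`, `logLookup_of_perm_segLog`, `init_mem_eq_getD` — segment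
  logs, lookups in permuted segment logs, the initial memory of the word RAM as a word list;
  `clausePass_eq`, `formulaPass_spec` — **the log built is a permutation of the segment log of
  the data words** (`dataWords`), the address counter ends past them, empty clauses only raise
  the flag;
* `frontEnd` / `runs_frontEnd` — **the whole front end**: from `inp = bits (hdrToks n ++
  formulaToks F)` to `nb = encodeNat n`, `he = flag ([] ∈ F)`, `mem =` a permutation of
  `segLog 0 (wordsOf n F)`, `wr = 1^{kW (T + n + 1)}`, `run = [1]`, within `frontCost kW n T`
  steps (a polynomial in `kW`, `n`, `T`).

## References

* S. A. Cook, R. A. Reckhow, *Time bounded random access machines*, JCSS 7 (1973) 354–375, §2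
  (random-access machines simulated by multitape Turing machines; the input convention).
* R. Impagliazzo, R. Paturi, F. Zane, *Which problems have strongly exponential complexity?*,
  JCSS 63 (2001) 512–530, §2 (formulas given as clause lists).
* T. Nipkow, G. Klein, *Concrete Semantics with Isabelle/HOL*, Springer 2014, Ch. 7 (big-step
  reasoning about structured programs).
-/

namespace Literature.Computability.Cryptography.KCNFToRAM

open _root_.Computability Complexity Complexity.Com WordRAM.ToTM2
open WordRAM.ToTM2.St
open FineGrained.LightSearch (bits hdrToks formulaToks formulaOf litToks clauseToks)

/-! ### The state of the front end -/

/-- The abstract state of the token pass: next free address `A`, address `A0` reserved for the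
length of the open clause (`0` if none), number `c` of literals read in the open clause, number
`m` of closed clauses, number `T` of tokens read, inside-a-clause flag `ic`, empty-clause flag
`e`, the bits of the literal being read (last on top), the log, header mode `hm`, the header bits
read so far (last on top). [folklore] -/
structure FS where
  A : ℕ
  A0 : ℕ
  c : ℕ
  m : ℕ
  T : ℕ
  ic : Bool
  e : Bool
  lit : List Bool
  E : List (List Bool × List Bool)
  hm : Bool
  nr : List Bool

/-- The register file of an abstract state, the remaining input bits being `inp`. [folklore] -/
def fsSt (s : FS) (inp : List Bool) : St :=
  { St.zero with
    inp := inp, nrev := s.nr, nrev2 := s.nr, tokc := ones s.T, adr := encodeNat s.A, a0 := encodeNat s.A0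
    cl := encodeNat s.c, mc := encodeNat s.m, lit := s.lit, he := flag s.e, incl := flag s.ic
    mem := encLog s.E, ph := flag s.hm }

/-! ### The handlers -/

/-- Start of a clause (at its first literal): reserve the current address for the length,
advance the address, raise `incl`. [folklore] -/
def clauseStart : Com (K ⊕ AReg) :=
  (copy (Sum.inl K.adr) (Sum.inl K.a0) (Sum.inl K.tmp) (Sum.inr AReg.s) ;;
    incr (Sum.inl K.adr) (Sum.inl K.it1) (Sum.inl K.it2) (Sum.inl K.ifl)) ;;
  push (Sum.inl K.incl) true

/-- Token `pol b` in formula mode: maybe start a clause, then start the literal with its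
polarity bit; count the token. [folklore] -/
def onPol (b : Bool) : Com (K ⊕ AReg) :=
  (ifFlag (Sum.inl K.incl) skip clauseStart ;; push (Sum.inl K.lit) b) ;; push (Sum.inl K.tokc) true

/-- Token `bit b` in formula mode: one more bit of the literal. [folklore] -/
def onBit (b : Bool) : Com (K ⊕ AReg) :=
  push (Sum.inl K.lit) b ;; push (Sum.inl K.tokc) true

/-- Token `endl` in formula mode: the literal is complete — its value (the bits read, polarity
first, normalised) is written at the current address, which advances; the literal count of the
clause advances. [folklore] -/
def onEndl : Com (K ⊕ AReg) :=
  (((((pour (Sum.inl K.lit) (Sum.inr AReg.x) ;; bk normalize) ;;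
    copy (Sum.inl K.adr) (Sum.inl K.key) (Sum.inl K.tmp) (Sum.inr AReg.s)) ;; memWrite) ;;
    incr (Sum.inl K.adr) (Sum.inl K.it1) (Sum.inl K.it2) (Sum.inl K.ifl)) ;;
    incr (Sum.inl K.cl) (Sum.inl K.it1) (Sum.inl K.it2) (Sum.inl K.ifl)) ;;
  push (Sum.inl K.tokc) true

/-- End of a nonempty clause: write its length at the reserved address, count the clause, lower
`incl`. [folklore] -/
def clauseEnd : Com (K ⊕ AReg) :=
  (((move (Sum.inl K.cl) (Sum.inr AReg.x) (Sum.inl K.tmp) ;; move (Sum.inl K.a0) (Sum.inl K.key) (Sum.inl K.tmp)) ;;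
    memWrite) ;; incr (Sum.inl K.mc) (Sum.inl K.it1) (Sum.inl K.it2) (Sum.inl K.ifl)) ;;
  clear (Sum.inl K.incl)

/-- Raise the empty-clause flag. [folklore] -/
def setHe : Com (K ⊕ AReg) := clear (Sum.inl K.he) ;; push (Sum.inl K.he) true

/-- Token `endc` in formula mode: close the clause, or record an empty clause. [folklore] -/
def onEndc : Com (K ⊕ AReg) :=
  ifFlag (Sum.inl K.incl) clauseEnd setHe ;; push (Sum.inl K.tokc) true

/-- Token `bit b` in header mode: one more bit of `numVars` (kept twice). [folklore] -/
def hdrBit (b : Bool) : Com (K ⊕ AReg) :=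
  (push (Sum.inl K.nrev) b ;; push (Sum.inl K.nrev2) b) ;; push (Sum.inl K.tokc) true

/-- Token `endl` in header mode: leave header mode. [folklore] -/
def hdrEndl : Com (K ⊕ AReg) :=
  pop (Sum.inl K.ph) skip skip skip ;; push (Sum.inl K.tokc) true

/-- An unexpected token: just count it. [folklore] -/
def junkTok : Com (K ⊕ AReg) := push (Sum.inl K.tokc) true

/-! ### Effects of the handlers -/

/-- `junkTok` counts the token. [folklore] -/
theorem runs_junkTok (s : FS) (inp : List Bool) :
    Runs junkTok (state (fsSt s inp) F0) (state (fsSt { s with T := s.T + 1 } inp) F0) 1 := by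
  have h := Runs.push (Sum.inl K.tokc) true (state (fsSt s inp) F0)
  simp only [state, Sum.elim_inl, regs_tokc, Sum.update_elim_inl, update_regs_tokc] at h
  refine h.of_eq ?_ le_rfl
  simp [state, fsSt, ones, List.replicate_succ]

/-- `onBit b` in formula mode. [folklore] -/
theorem runs_onBit (b : Bool) (s : FS) (inp : List Bool) :
    Runs (onBit b) (state (fsSt s inp) F0) (state (fsSt { s with lit := b :: s.lit, T := s.T + 1 } inp) F0) 2 := by
  have h := (Runs.push (Sum.inl K.lit) b (state (fsSt s inp) F0)).seq (Runs.push (Sum.inl K.tokc) true _)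
  simp only [state, Sum.elim_inl, regs_lit, Sum.update_elim_inl, update_regs_lit, regs_tokc, update_regs_tokc] at h
  refine h.of_eq ?_ le_rfl
  simp [state, fsSt, ones, List.replicate_succ]

/-- `hdrBit b` in header mode. [folklore] -/
theorem runs_hdrBit (b : Bool) (s : FS) (inp : List Bool) :
    Runs (hdrBit b) (state (fsSt s inp) F0) (state (fsSt { s with nr := b :: s.nr, T := s.T + 1 } inp) F0) 3 := by
  have h := ((Runs.push (Sum.inl K.nrev) b (state (fsSt s inp) F0)).seq (Runs.push (Sum.inl K.nrev2) b _)).seq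
    (Runs.push (Sum.inl K.tokc) true _)
  simp only [state, Sum.elim_inl, regs_nrev, Sum.update_elim_inl, update_regs_nrev, regs_nrev2, update_regs_nrev2,
    regs_tokc, update_regs_tokc] at h
  refine h.of_eq ?_ le_rfl
  simp [state, fsSt, ones, List.replicate_succ]

/-- `hdrEndl` in header mode. [folklore] -/
theorem runs_hdrEndl (s : FS) (inp : List Bool) (hhm : s.hm = true) :
    Runs hdrEndl (state (fsSt s inp) F0) (state (fsSt { s with hm := false, T := s.T + 1 } inp) F0) 3 := by
  have h1 : Runs (pop (Sum.inl K.ph) skip skip skip) (state (fsSt s inp) F0)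
      (state (fsSt { s with hm := false } inp) F0) 2 :=
    Runs.pop_true' _ _ (w := []) (by simp [state, fsSt, hhm]) (by simp [state, fsSt]) (Runs.skip _)
  have h := h1.seq (Runs.push (Sum.inl K.tokc) true _)
  simp only [state, Sum.elim_inl, regs_tokc, Sum.update_elim_inl, update_regs_tokc] at h
  refine h.of_eq ?_ le_rfl
  simp [state, fsSt, ones, List.replicate_succ]

/-- `clauseStart` (no clause open, `A0 = 0`): `A0 := A`, `A := A + 1`, `incl` raised. [folklore] -/
theorem runs_clauseStart (s : FS) (inp : List Bool) (hic : s.ic = false) (hA0 : s.A0 = 0) :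
    Runs clauseStart (state (fsSt s inp) F0) (state (fsSt { s with A0 := s.A, A := s.A + 1, ic := true } inp) F0)
      (19 * (encodeNat s.A).length + 18) := by
  have h1 := runs_copy (a := (Sum.inl K.adr : K ⊕ AReg)) (b := Sum.inl K.a0) (t := Sum.inl K.tmp) (u := Sum.inr AReg.s)
    (by simp) (by simp) (by simp) (by simp) (by simp) (by simp) (state (fsSt s inp) F0) (by simp [state, fsSt])
    (by simp [state, fsSt])
  have h2 := h1.seq (runs_incr (B := (Sum.inl K.adr : K ⊕ AReg)) (t := Sum.inl K.it1) (t2 := Sum.inl K.it2)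
    (fl := Sum.inl K.ifl) (by simp) (by simp) (by simp) (by simp) (by simp) (by simp) _ (by simp [state, fsSt])
    (by simp [state, fsSt]) (by simp [state, fsSt]))
  have h3 := h2.seq (Runs.push (Sum.inl K.incl) true _)
  simp only [state, Sum.elim_inl, regs_adr, regs_a0, Sum.update_elim_inl, update_regs_a0, update_regs_adr,
    regs_incl, update_regs_incl] at h3
  refine h3.of_eq ?_ (by simp [fsSt]; omega)
  simp [state, fsSt, hic, hA0, ← TokConv.encodeNat_succ_eq_incRes, TokConv.encodeNat_zero']

/-- Model of `onPol`. [folklore] -/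
def polStep (s : FS) (b : Bool) : FS :=
  if s.ic then { s with lit := b :: s.lit, T := s.T + 1 }
  else { s with A0 := s.A, A := s.A + 1, ic := true, lit := b :: s.lit, T := s.T + 1 }

/-- `onPol b` in formula mode. [folklore] -/
theorem runs_onPol (b : Bool) (s : FS) (inp : List Bool) (hA0 : s.ic = false → s.A0 = 0) :
    Runs (onPol b) (state (fsSt s inp) F0) (state (fsSt (polStep s b) inp) F0) (19 * (encodeNat s.A).length + 23) := by
  unfold polStep
  cases hic : s.ic
  · have h1 := runs_ifFlag_false skip (F := (Sum.inl K.incl : K ⊕ AReg)) (by simp [state, fsSt, hic])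
      (runs_clauseStart s inp hic (hA0 hic))
    have h2 := (h1.seq (Runs.push (Sum.inl K.lit) b _)).seq (Runs.push (Sum.inl K.tokc) true _)
    simp only [state, Sum.elim_inl, regs_lit, Sum.update_elim_inl, update_regs_lit, regs_tokc, update_regs_tokc] at h2
    refine h2.of_eq ?_ (by omega)
    simp [state, fsSt, ones, List.replicate_succ]
  · have h1 := runs_ifFlag_true clauseStart (F := (Sum.inl K.incl : K ⊕ AReg)) (by simp [state, fsSt, hic])
      (Runs.skip (state (fsSt s inp) F0))
    have h2 := (h1.seq (Runs.push (Sum.inl K.lit) b _)).seq (Runs.push (Sum.inl K.tokc) true _)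
    simp only [state, Sum.elim_inl, regs_lit, Sum.update_elim_inl, update_regs_lit, regs_tokc, update_regs_tokc] at h2
    refine h2.of_eq ?_ (by omega)
    simp [state, fsSt, ones, List.replicate_succ, hic]

/-- `onEndl` in formula mode: write the literal, advance the address and the literal count.
[folklore] -/
theorem runs_onEndl (s : FS) (inp : List Bool) :
    Runs onEndl (state (fsSt s inp) F0)
      (state (fsSt
        { s with E := (encodeNat s.A, norm s.lit.reverse) :: s.E, A := s.A + 1, c := s.c + 1, lit := [], T := s.T + 1 }
        inp) F0)
      (19 * s.lit.length + 26 * (encodeNat s.A).length + 9 * (encodeNat s.c).length + 45) := by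
  have h1 := runs_pour (a := (Sum.inl K.lit : K ⊕ AReg)) (b := Sum.inr AReg.x) (by simp) (state (fsSt s inp) F0)
  simp only [state, Sum.elim_inl, regs_lit, Sum.elim_inr, AReg.file_x, List.append_nil, Sum.update_elim_inl,
    update_regs_lit, Sum.update_elim_inr, AReg.update_file_x] at h1
  have h2 := h1.seq ((runs_normalize s.lit.reverse [] [] [] [] []).inr _)
  have h3 := h2.seq (runs_copy (a := (Sum.inl K.adr : K ⊕ AReg)) (b := Sum.inl K.key) (t := Sum.inl K.tmp)
    (u := Sum.inr AReg.s) (by simp) (by simp) (by simp) (by simp) (by simp) (by simp) _ (by simp [fsSt])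
    (by simp [fsSt]))
  simp only [Sum.elim_inl, regs_adr, regs_key, Sum.update_elim_inl, update_regs_key] at h3
  have h4 := h3.seq (runs_memWrite _ s.E (encodeNat s.A) (norm s.lit.reverse) [] [] [] [] [] [] []
    (by simp [fsSt]) (by simp [fsSt]) (by simp [fsSt]))
  have h5 := h4.seq (runs_incr (B := (Sum.inl K.adr : K ⊕ AReg)) (t := Sum.inl K.it1) (t2 := Sum.inl K.it2)
    (fl := Sum.inl K.ifl) (by simp) (by simp) (by simp) (by simp) (by simp) (by simp) _ (by simp [state, fsSt])
    (by simp [state, fsSt]) (by simp [state, fsSt]))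
  have h6 := h5.seq (runs_incr (B := (Sum.inl K.cl : K ⊕ AReg)) (t := Sum.inl K.it1) (t2 := Sum.inl K.it2)
    (fl := Sum.inl K.ifl) (by simp) (by simp) (by simp) (by simp) (by simp) (by simp) _ (by simp [state, fsSt])
    (by simp [state, fsSt]) (by simp [state, fsSt]))
  have h7 := h6.seq (Runs.push (Sum.inl K.tokc) true _)
  simp only [state, Sum.elim_inl, regs_adr, Sum.update_elim_inl, update_regs_adr, regs_cl, update_regs_cl, regs_tokc,
    update_regs_tokc] at h7
  refine h7.of_eq ?_ ?_
  · simp [state, fsSt, ones, List.replicate_succ, ← TokConv.encodeNat_succ_eq_incRes]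
  · have l1 := length_norm_le s.lit.reverse
    simp only [fsSt, List.length_reverse] at l1 ⊢
    omega

/-- `clauseEnd` (a clause is open): write its length, count it, lower `incl`; `A0`, `c` reset.
[folklore] -/
theorem runs_clauseEnd (s : FS) (inp : List Bool) (hic : s.ic = true) :
    Runs clauseEnd (state (fsSt s inp) F0)
      (state (fsSt { s with E := (encodeNat s.A0, encodeNat s.c) :: s.E, m := s.m + 1, ic := false, c := 0, A0 := 0 }
        inp) F0)
      (13 * ((encodeNat s.c).length + (encodeNat s.A0).length) + 9 * (encodeNat s.m).length + 28) := by
  have h1 := runs_move (a := (Sum.inl K.cl : K ⊕ AReg)) (b := Sum.inr AReg.x) (t := Sum.inl K.tmp) (by simp) (by simp)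
    (by simp) (state (fsSt s inp) F0) (by simp [state, fsSt])
  have h2 := h1.seq (runs_move (a := (Sum.inl K.a0 : K ⊕ AReg)) (b := Sum.inl K.key) (t := Sum.inl K.tmp) (by simp)
    (by simp) (by simp) _ (by simp [state, fsSt]))
  simp only [state, Sum.elim_inl, regs_cl, Sum.elim_inr, AReg.file_x, List.append_nil, Sum.update_elim_inl,
    update_regs_cl, Sum.update_elim_inr, AReg.update_file_x, regs_a0, regs_key, update_regs_a0, update_regs_key] at h2
  have h3 := h2.seq (runs_memWrite _ s.E (encodeNat s.A0) (encodeNat s.c) [] [] [] [] [] [] [] (by simp [fsSt])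
    (by simp [fsSt]) (by simp [fsSt]))
  have h4 := h3.seq (runs_incr (B := (Sum.inl K.mc : K ⊕ AReg)) (t := Sum.inl K.it1) (t2 := Sum.inl K.it2)
    (fl := Sum.inl K.ifl) (by simp) (by simp) (by simp) (by simp) (by simp) (by simp) _ (by simp [state, fsSt])
    (by simp [state, fsSt]) (by simp [state, fsSt]))
  have h5 := h4.seq (runs_clear (Sum.inl K.incl : K ⊕ AReg) _)
  simp only [state, Sum.elim_inl, regs_mc, Sum.update_elim_inl, update_regs_mc, regs_incl, update_regs_incl] at h5
  refine h5.of_eq ?_ ?_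
  · simp [state, fsSt, ← TokConv.encodeNat_succ_eq_incRes, TokConv.encodeNat_zero']
  · simp only [fsSt, hic, flag_true, List.length_singleton]
    omega

/-- `setHe`: raise the empty-clause flag. [folklore] -/
theorem runs_setHe (s : FS) (inp : List Bool) :
    Runs setHe (state (fsSt s inp) F0) (state (fsSt { s with e := true } inp) F0) 4 := by
  have h1 := runs_clear_flag (Sum.inl K.he : K ⊕ AReg) (R := state (fsSt s inp) F0) (by simp [state, fsSt, length_flag_le])
  have h2 := h1.seq (Runs.push (Sum.inl K.he) true _)
  simp only [state, Sum.update_elim_inl, update_regs_he, Sum.elim_inl, regs_he] at h2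
  refine h2.of_eq ?_ le_rfl
  simp [state, fsSt]

/-- Model of `onEndc`. [folklore] -/
def endcStep (s : FS) : FS :=
  if s.ic then { s with E := (encodeNat s.A0, encodeNat s.c) :: s.E, m := s.m + 1, ic := false, c := 0, A0 := 0, T := s.T + 1 }
  else { s with e := true, T := s.T + 1 }

/-- `onEndc` in formula mode. [folklore] -/
theorem runs_onEndc (s : FS) (inp : List Bool) :
    Runs onEndc (state (fsSt s inp) F0) (state (fsSt (endcStep s) inp) F0)
      (13 * ((encodeNat s.c).length + (encodeNat s.A0).length) + 9 * (encodeNat s.m).length + 32) := by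
  unfold endcStep
  cases hic : s.ic
  · have h1 := runs_ifFlag_false clauseEnd (F := (Sum.inl K.incl : K ⊕ AReg)) (by simp [state, fsSt, hic])
      (runs_setHe s inp)
    have h2 := h1.seq (Runs.push (Sum.inl K.tokc) true _)
    simp only [state, Sum.elim_inl, regs_tokc, Sum.update_elim_inl, update_regs_tokc] at h2
    refine h2.of_eq ?_ (by omega)
    simp [state, fsSt, ones, List.replicate_succ, hic]
  · have h1 := runs_ifFlag_true setHe (F := (Sum.inl K.incl : K ⊕ AReg)) (by simp [state, fsSt, hic])
      (runs_clauseEnd s inp hic)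
    have h2 := h1.seq (Runs.push (Sum.inl K.tokc) true _)
    simp only [state, Sum.elim_inl, regs_tokc, Sum.update_elim_inl, update_regs_tokc] at h2
    refine h2.of_eq ?_ (by omega)
    simp [state, fsSt, ones, List.replicate_succ]

/-! ### The token loop -/

/-- Token `bit b`: header bit or literal bit according to the mode. [folklore] -/
def onBitTok (b : Bool) : Com (K ⊕ AReg) := ifFlag (Sum.inl K.ph) (hdrBit b) (onBit b)

/-- Token `pol b`: start of a literal (ignored in header mode). [folklore] -/
def polTok (b : Bool) : Com (K ⊕ AReg) := ifFlag (Sum.inl K.ph) junkTok (onPol b)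

/-- Token `endl`: end of the header or of a literal. [folklore] -/
def endlTok : Com (K ⊕ AReg) := ifFlag (Sum.inl K.ph) hdrEndl onEndl

/-- Token `endc`: end of a clause (ignored in header mode). [folklore] -/
def endcTok : Com (K ⊕ AReg) := ifFlag (Sum.inl K.ph) junkTok onEndc

/-- Decoding the prefix code of tokens (`bit b ↦ 1b`, `pol b ↦ 01b`, `endl ↦ 001`, `endc ↦ 0000`,
`endf ↦ 00010`, `unit ↦ 00011`) after its first bit, and dispatch. [folklore] -/
def tokCase : Bool → Com (K ⊕ AReg)
  | true => pop (Sum.inl K.inp) (onBitTok true) (onBitTok false) junkTok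
  | false => pop (Sum.inl K.inp)
      (pop (Sum.inl K.inp) (polTok true) (polTok false) junkTok)
      (pop (Sum.inl K.inp) endlTok
        (pop (Sum.inl K.inp) (pop (Sum.inl K.inp) junkTok junkTok junkTok) endcTok junkTok) junkTok)
      junkTok

/-- The token loop over the input register. [folklore] -/
def mainLoop : Com (K ⊕ AReg) := loop (Sum.inl K.inp) (tokCase true) (tokCase false)

/-- Model of `onEndl`. [folklore] -/
def endlStep (s : FS) : FS :=
  { s with E := (encodeNat s.A, norm s.lit.reverse) :: s.E, A := s.A + 1, c := s.c + 1, lit := [], T := s.T + 1 }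

/-- Model of one token. [folklore] -/
def tokStep (s : FS) : FineGrained.LightSearch.Tok → FS
  | .bit b => if s.hm then { s with nr := b :: s.nr, T := s.T + 1 } else { s with lit := b :: s.lit, T := s.T + 1 }
  | .pol b => if s.hm then { s with T := s.T + 1 } else polStep s b
  | .endl => if s.hm then { s with hm := false, T := s.T + 1 } else endlStep s
  | .endc => if s.hm then { s with T := s.T + 1 } else endcStep s
  | .endf => { s with T := s.T + 1 }
  | .unit => { s with T := s.T + 1 }

/-- The invariant of the pass: outside a clause no address is reserved. [folklore] -/
def FS.inv (s : FS) : Prop := s.ic = false → s.A0 = 0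

/-- The invariant is preserved by every token. [folklore] -/
theorem FS.inv_tokStep {s : FS} (h : s.inv) (t : FineGrained.LightSearch.Tok) : (tokStep s t).inv := by
  unfold FS.inv at h ⊢
  cases t <;> simp only [tokStep, polStep, endlStep, endcStep] <;> (try split) <;> (try split) <;> simp_all

/-- A uniform bound of the cost of one token, for numerals and literals of size at most `N`.
[folklore] -/
def tokCostB (N : ℕ) : ℕ := 19 * N + 61 * (encodeNat N).length + 70

/-- `Bnd N k s`: the counters of `s` stay below `N` for `k` more tokens. [folklore] -/
structure Bnd (N k : ℕ) (s : FS) : Prop where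
  hA : s.A + k ≤ N
  hc : s.c + k ≤ N
  hm : s.m + k ≤ N
  hA0 : s.A0 ≤ N
  hlit : s.lit.length + k ≤ N

/-- `Bnd` passes to the next token. [folklore] -/
theorem Bnd.next {N k : ℕ} {s : FS} (h : Bnd N (k + 1) s) (t : FineGrained.LightSearch.Tok) : Bnd N k (tokStep s t) := by
  obtain ⟨hA, hc, hm, hA0, hlit⟩ := h
  cases t <;> simp only [tokStep, polStep, endlStep, endcStep] <;> (try split) <;> (try split) <;>
    exact ⟨by (simp only []; omega), by (simp only []; omega), by (simp only []; omega), by (simp only []; omega),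
      by ((try simp only [List.length_cons, List.length_nil]); omega)⟩

/-- Updating the input register of a front-end file. [folklore] -/
theorem update_inp (s : FS) (l l' : List Bool) :
    Function.update (state (fsSt s l) F0) (Sum.inl K.inp) l' = state (fsSt s l') F0 := by
  simp [state, fsSt]

/-- Popping a `1` from the input. [folklore] -/
theorem pop_inp_true {ct cf cn : Com (K ⊕ AReg)} {s : FS} {l : List Bool} {R' : Regs (K ⊕ AReg)} {B : ℕ}
    (h : Runs ct (state (fsSt s l) F0) R' B) : Runs (pop (Sum.inl K.inp) ct cf cn) (state (fsSt s (true :: l)) F0) R' (B + 2) :=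
  Runs.pop_true' _ _ (by simp [state, fsSt]) (update_inp s _ _) h

/-- Popping a `0` from the input. [folklore] -/
theorem pop_inp_false {ct cf cn : Com (K ⊕ AReg)} {s : FS} {l : List Bool} {R' : Regs (K ⊕ AReg)} {B : ℕ}
    (h : Runs cf (state (fsSt s l) F0) R' B) : Runs (pop (Sum.inl K.inp) ct cf cn) (state (fsSt s (false :: l)) F0) R' (B + 2) :=
  Runs.pop_false' _ _ (by simp [state, fsSt]) (update_inp s _ _) h

/-- One iteration of the token loop on a leading `1`. [folklore] -/
theorem loop_inp_true {s : FS} {l : List Bool} {R₁ R₂ : Regs (K ⊕ AReg)} {B₁ B₂ : ℕ}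
    (h₁ : Runs (tokCase true) (state (fsSt s l) F0) R₁ B₁) (h₂ : Runs mainLoop R₁ R₂ B₂) :
    Runs mainLoop (state (fsSt s (true :: l)) F0) R₂ (B₁ + 2 + B₂) :=
  Runs.loop_true (w := l) (by simp [state, fsSt]) (by rw [update_inp]; exact h₁) h₂

/-- One iteration of the token loop on a leading `0`. [folklore] -/
theorem loop_inp_false {s : FS} {l : List Bool} {R₁ R₂ : Regs (K ⊕ AReg)} {B₁ B₂ : ℕ}
    (h₁ : Runs (tokCase false) (state (fsSt s l) F0) R₁ B₁) (h₂ : Runs mainLoop R₁ R₂ B₂) :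
    Runs mainLoop (state (fsSt s (false :: l)) F0) R₂ (B₁ + 2 + B₂) :=
  Runs.loop_false (w := l) (by simp [state, fsSt]) (by rw [update_inp]; exact h₁) h₂

/-- Branching on the mode flag, header mode. [folklore] -/
theorem ifFlag_ph_true {c₁ c₂ : Com (K ⊕ AReg)} {s : FS} (hhm : s.hm = true) {l : List Bool} {R' : Regs (K ⊕ AReg)}
    {B : ℕ} (h : Runs c₁ (state (fsSt s l) F0) R' B) : Runs (ifFlag (Sum.inl K.ph) c₁ c₂) (state (fsSt s l) F0) R' (B + 3) :=
  runs_ifFlag_true c₂ (by simp [state, fsSt, hhm]) h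

/-- Branching on the mode flag, formula mode. [folklore] -/
theorem ifFlag_ph_false {c₁ c₂ : Com (K ⊕ AReg)} {s : FS} (hhm : s.hm = false) {l : List Bool} {R' : Regs (K ⊕ AReg)}
    {B : ℕ} (h : Runs c₂ (state (fsSt s l) F0) R' B) : Runs (ifFlag (Sum.inl K.ph) c₁ c₂) (state (fsSt s l) F0) R' (B + 3) :=
  runs_ifFlag_false c₁ (by simp [state, fsSt, hhm]) h

/-- The cost of one token against the uniform bound. [folklore] -/
theorem tokCost_le {N k : ℕ} {s : FS} (hb : Bnd N (k + 1) s) :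
    19 * s.lit.length + 26 * (encodeNat s.A).length + 13 * ((encodeNat s.c).length + (encodeNat s.A0).length) +
      9 * (encodeNat s.m).length + 56 ≤ tokCostB N := by
  obtain ⟨hA, hc, hm, hA0, hlit⟩ := hb
  have e1 := Brick.length_encodeNat_mono (show s.A ≤ N by omega)
  have e2 := Brick.length_encodeNat_mono (show s.c ≤ N by omega)
  have e3 := Brick.length_encodeNat_mono (show s.m ≤ N by omega)
  have e4 := Brick.length_encodeNat_mono hA0
  unfold tokCostB
  omega

/-- **One token** (continuation form): the token loop on `t.code ++ rest` first acts as
`tokStep s t`, within `tokCostB N` steps. [folklore] -/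
theorem mainLoop_tok {N k : ℕ} (t : FineGrained.LightSearch.Tok) (s : FS) (hs : s.inv) (hb : Bnd N (k + 1) s) (rest : List Bool)
    {Rfin : Regs (K ⊕ AReg)} {Bc : ℕ} (hcont : Runs mainLoop (state (fsSt (tokStep s t) rest) F0) Rfin Bc) :
    Runs mainLoop (state (fsSt s (t.code ++ rest)) F0) Rfin (tokCostB N + Bc) := by
  have hcb := tokCost_le hb
  obtain ⟨A, A0, c, m, T, ic, e, lit, E, hm, nr⟩ := s
  simp only [] at hcb
  cases hm
  · -- formula mode
    cases t with
    | bit b =>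
      have h' : Runs (tokCase true) (state (fsSt ⟨A, A0, c, m, T, ic, e, lit, E, false, nr⟩ (b :: rest)) F0)
          (state (fsSt (tokStep ⟨A, A0, c, m, T, ic, e, lit, E, false, nr⟩ (.bit b)) rest) F0) (2 + 3 + 2) := by
        simp only [tokStep, Bool.false_eq_true, ↓reduceIte]
        cases b
        · exact pop_inp_false (ifFlag_ph_false rfl (runs_onBit false _ rest))
        · exact pop_inp_true (ifFlag_ph_false rfl (runs_onBit true _ rest))
      exact (loop_inp_true h' hcont).of_eq rfl (by omega)
    | pol b =>
      have h' : Runs (tokCase false) (state (fsSt ⟨A, A0, c, m, T, ic, e, lit, E, false, nr⟩ (true :: b :: rest)) F0)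
          (state (fsSt (tokStep ⟨A, A0, c, m, T, ic, e, lit, E, false, nr⟩ (.pol b)) rest) F0)
          (19 * (encodeNat A).length + 23 + 3 + 2 + 2) := by
        simp only [tokStep, Bool.false_eq_true, ↓reduceIte]
        cases b
        · exact pop_inp_true (pop_inp_false (ifFlag_ph_false rfl (runs_onPol false _ rest hs)))
        · exact pop_inp_true (pop_inp_true (ifFlag_ph_false rfl (runs_onPol true _ rest hs)))
      exact (loop_inp_false h' hcont).of_eq rfl (by omega)
    | endl =>
      have h' : Runs (tokCase false) (state (fsSt ⟨A, A0, c, m, T, ic, e, lit, E, false, nr⟩ (false :: true :: rest)) F0)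
          (state (fsSt (tokStep ⟨A, A0, c, m, T, ic, e, lit, E, false, nr⟩ .endl) rest) F0)
          (19 * lit.length + 26 * (encodeNat A).length + 9 * (encodeNat c).length + 45 + 3 + 2 + 2) := by
        simp only [tokStep, Bool.false_eq_true, ↓reduceIte, endlStep]
        exact pop_inp_false (pop_inp_true (ifFlag_ph_false rfl (runs_onEndl _ rest)))
      exact (loop_inp_false h' hcont).of_eq rfl (by omega)
    | endc =>
      have h' : Runs (tokCase false)
          (state (fsSt ⟨A, A0, c, m, T, ic, e, lit, E, false, nr⟩ (false :: false :: false :: rest)) F0)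
          (state (fsSt (tokStep ⟨A, A0, c, m, T, ic, e, lit, E, false, nr⟩ .endc) rest) F0)
          (13 * ((encodeNat c).length + (encodeNat A0).length) + 9 * (encodeNat m).length + 32 + 3 + 2 + 2 + 2) := by
        simp only [tokStep, Bool.false_eq_true, ↓reduceIte]
        exact pop_inp_false (pop_inp_false (pop_inp_false (ifFlag_ph_false rfl (runs_onEndc _ rest))))
      exact (loop_inp_false h' hcont).of_eq rfl (by omega)
    | endf =>
      have h' : Runs (tokCase false)
          (state (fsSt ⟨A, A0, c, m, T, ic, e, lit, E, false, nr⟩ (false :: false :: true :: false :: rest)) F0)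
          (state (fsSt (tokStep ⟨A, A0, c, m, T, ic, e, lit, E, false, nr⟩ .endf) rest) F0) (1 + 2 + 2 + 2 + 2) := by
        simp only [tokStep]
        exact pop_inp_false (pop_inp_false (pop_inp_true (pop_inp_false (runs_junkTok _ rest))))
      exact (loop_inp_false h' hcont).of_eq rfl (by omega)
    | unit =>
      have h' : Runs (tokCase false)
          (state (fsSt ⟨A, A0, c, m, T, ic, e, lit, E, false, nr⟩ (false :: false :: true :: true :: rest)) F0)
          (state (fsSt (tokStep ⟨A, A0, c, m, T, ic, e, lit, E, false, nr⟩ .unit) rest) F0) (1 + 2 + 2 + 2 + 2) := by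
        simp only [tokStep]
        exact pop_inp_false (pop_inp_false (pop_inp_true (pop_inp_true (runs_junkTok _ rest))))
      exact (loop_inp_false h' hcont).of_eq rfl (by omega)
  · -- header mode
    cases t with
    | bit b =>
      have h' : Runs (tokCase true) (state (fsSt ⟨A, A0, c, m, T, ic, e, lit, E, true, nr⟩ (b :: rest)) F0)
          (state (fsSt (tokStep ⟨A, A0, c, m, T, ic, e, lit, E, true, nr⟩ (.bit b)) rest) F0) (3 + 3 + 2) := by
        simp only [tokStep, ↓reduceIte]
        cases b
        · exact pop_inp_false (ifFlag_ph_true rfl (runs_hdrBit false _ rest))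
        · exact pop_inp_true (ifFlag_ph_true rfl (runs_hdrBit true _ rest))
      exact (loop_inp_true h' hcont).of_eq rfl (by omega)
    | pol b =>
      have h' : Runs (tokCase false) (state (fsSt ⟨A, A0, c, m, T, ic, e, lit, E, true, nr⟩ (true :: b :: rest)) F0)
          (state (fsSt (tokStep ⟨A, A0, c, m, T, ic, e, lit, E, true, nr⟩ (.pol b)) rest) F0) (1 + 3 + 2 + 2) := by
        simp only [tokStep, ↓reduceIte]
        cases b
        · exact pop_inp_true (pop_inp_false (ifFlag_ph_true rfl (runs_junkTok _ rest)))
        · exact pop_inp_true (pop_inp_true (ifFlag_ph_true rfl (runs_junkTok _ rest)))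
      exact (loop_inp_false h' hcont).of_eq rfl (by omega)
    | endl =>
      have h' : Runs (tokCase false) (state (fsSt ⟨A, A0, c, m, T, ic, e, lit, E, true, nr⟩ (false :: true :: rest)) F0)
          (state (fsSt (tokStep ⟨A, A0, c, m, T, ic, e, lit, E, true, nr⟩ .endl) rest) F0) (3 + 3 + 2 + 2) := by
        simp only [tokStep, ↓reduceIte]
        exact pop_inp_false (pop_inp_true (ifFlag_ph_true rfl (runs_hdrEndl _ rest rfl)))
      exact (loop_inp_false h' hcont).of_eq rfl (by omega)
    | endc =>
      have h' : Runs (tokCase false)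
          (state (fsSt ⟨A, A0, c, m, T, ic, e, lit, E, true, nr⟩ (false :: false :: false :: rest)) F0)
          (state (fsSt (tokStep ⟨A, A0, c, m, T, ic, e, lit, E, true, nr⟩ .endc) rest) F0) (1 + 3 + 2 + 2 + 2) := by
        simp only [tokStep, ↓reduceIte]
        exact pop_inp_false (pop_inp_false (pop_inp_false (ifFlag_ph_true rfl (runs_junkTok _ rest))))
      exact (loop_inp_false h' hcont).of_eq rfl (by omega)
    | endf =>
      have h' : Runs (tokCase false)
          (state (fsSt ⟨A, A0, c, m, T, ic, e, lit, E, true, nr⟩ (false :: false :: true :: false :: rest)) F0)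
          (state (fsSt (tokStep ⟨A, A0, c, m, T, ic, e, lit, E, true, nr⟩ .endf) rest) F0) (1 + 2 + 2 + 2 + 2) := by
        simp only [tokStep]
        exact pop_inp_false (pop_inp_false (pop_inp_true (pop_inp_false (runs_junkTok _ rest))))
      exact (loop_inp_false h' hcont).of_eq rfl (by omega)
    | unit =>
      have h' : Runs (tokCase false)
          (state (fsSt ⟨A, A0, c, m, T, ic, e, lit, E, true, nr⟩ (false :: false :: true :: true :: rest)) F0)
          (state (fsSt (tokStep ⟨A, A0, c, m, T, ic, e, lit, E, true, nr⟩ .unit) rest) F0) (1 + 2 + 2 + 2 + 2) := by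
        simp only [tokStep]
        exact pop_inp_false (pop_inp_false (pop_inp_true (pop_inp_true (runs_junkTok _ rest))))
      exact (loop_inp_false h' hcont).of_eq rfl (by omega)

/-- **The token loop** over a token string (from a state satisfying the invariant and the
bounds): it ends in the fold of `tokStep`, within `|ts| · tokCostB N + 1` steps. [folklore] -/
theorem mainLoop_toks {N : ℕ} : ∀ (ts : List FineGrained.LightSearch.Tok) (s : FS), s.inv → Bnd N ts.length s →
    Runs mainLoop (state (fsSt s (bits ts)) F0) (state (fsSt (ts.foldl tokStep s) []) F0) (ts.length * tokCostB N + 1)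
  | [], s, _, _ => (Runs.loop_nil _ _ (by simp [state, fsSt, bits])).of_eq (by simp) (by simp)
  | t :: ts, s, hs, hb => by
    have ih := mainLoop_toks ts (tokStep s t) (FS.inv_tokStep hs t) (hb.next t)
    have := mainLoop_tok t s hs hb (bits ts) ih
    rw [FineGrained.LightSearch.bits_cons]
    exact this.of_eq rfl (by simp [Nat.succ_mul]; omega)

/-! ### After the token loop: the six header entries -/

/-- The register file at the end of a well-formed token pass. [folklore] -/
theorem fsSt_final (A m T : ℕ) (e : Bool) (E : List (List Bool × List Bool)) (nr : List Bool) :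
    fsSt ⟨A, 0, 0, m, T, false, e, [], E, false, nr⟩ [] =
      { St.zero with
        nrev := nr, nrev2 := nr, tokc := ones T, adr := encodeNat A, mc := encodeNat m, he := flag e
        mem := encLog E } := by
  simp [fsSt, TokConv.encodeNat_zero', flag, St.zero]

/-- Entries `0 ↦ A - 1` (the length of the RAM input) and `1 ↦ n`; `n` is also kept on `nb`.
[folklore] -/
def hdrE01 : Com (K ⊕ AReg) :=
  ((((((((((copy (Sum.inl K.adr) (Sum.inr AReg.x) (Sum.inl K.tmp) (Sum.inr AReg.s) ;; push (Sum.inr AReg.y) true) ;;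
    bk sub) ;; clear (Sum.inr AReg.g)) ;; clear (Sum.inr AReg.y)) ;; bk normalize) ;; memWrite) ;;
    pour (Sum.inl K.nrev2) (Sum.inr AReg.x)) ;; copy (Sum.inr AReg.x) (Sum.inl K.nb) (Sum.inl K.tmp) (Sum.inr AReg.s)) ;;
    push (Sum.inl K.key) true) ;; memWrite)

/-- Effect of `hdrE01` (`A ≥ 1`, header bits those of `n`). [folklore] -/
theorem runs_hdrE01 (A m T n : ℕ) (hA : 1 ≤ A) (e : Bool) (E : List (List Bool × List Bool)) :
    Runs hdrE01
      (state { St.zero with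
        nrev := (encodeNat n).reverse, nrev2 := (encodeNat n).reverse, tokc := ones T
        adr := encodeNat A, mc := encodeNat m, he := flag e, mem := encLog E } F0)
      (state { St.zero with
        nrev := (encodeNat n).reverse, nb := encodeNat n, tokc := ones T
        adr := encodeNat A, mc := encodeNat m, he := flag e
        mem := encLog ((encodeNat 1, encodeNat n) :: (encodeNat 0, encodeNat (A - 1)) :: E) } F0)
      (70 * (encodeNat A).length + 24 * (encodeNat n).length + 80) := by
  have e1 : encodeNat 1 = [true] := by decide
  have hbor : subBorrow (encodeNat A) [true] = false := by
    rw [subBorrow_iff, bitsToNat_encodeNat]; simp; omega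
  have hval : norm (subRes (encodeNat A) [true]) = encodeNat (A - 1) := by
    rw [norm_eq_encodeNat, bitsToNat_subRes _ _ (by rw [bitsToNat_encodeNat]; simp; omega), bitsToNat_encodeNat]
    rfl
  have hlen : (subRes (encodeNat A) [true]).length = (encodeNat A).length := length_subRes _ _
  have c1 := runs_copy (a := (Sum.inl K.adr : K ⊕ AReg)) (b := Sum.inr AReg.x) (t := Sum.inl K.tmp) (u := Sum.inr AReg.s)
    (by simp) (by simp) (by simp) (by simp) (by simp) (by simp)
    (state { St.zero with
        nrev := (encodeNat n).reverse, nrev2 := (encodeNat n).reverse, tokc := ones T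
        adr := encodeNat A, mc := encodeNat m, he := flag e, mem := encLog E } F0) (by simp [state, St.zero]) (by simp [state])
  have c2 := c1.seq (Runs.push (Sum.inr AReg.y) true _)
  simp only [state, Sum.elim_inl, regs_adr, Sum.elim_inr, AReg.file_x, List.append_nil, Sum.update_elim_inr,
    AReg.update_file_x, AReg.file_y, AReg.update_file_y] at c2
  have c3 := c2.seq ((runs_sub (encodeNat A) [true] []).inr _)
  rw [hbor] at c3
  simp only [Bool.not_false, cond_false, flag_true] at c3
  have c5 := (c3.seq (runs_clear (Sum.inr AReg.g : K ⊕ AReg) _)).seq (runs_clear (Sum.inr AReg.y : K ⊕ AReg) _)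
  simp only [Sum.elim_inr, AReg.file_g, Sum.update_elim_inr, AReg.update_file_g, AReg.file_y, AReg.update_file_y,
    List.length_singleton] at c5
  have c6 := c5.seq ((runs_normalize (subRes (encodeNat A) [true]) [] [] [] [] []).inr _)
  rw [hval] at c6
  have c7 := c6.seq (runs_memWrite _ E (encodeNat 0) (encodeNat (A - 1)) [] [] [] [] [] [] [] (by simp)
    (by simp [St.zero, TokConv.encodeNat_zero']) (by simp [St.zero]))
  have c8 := c7.seq (runs_pour (a := (Sum.inl K.nrev2 : K ⊕ AReg)) (b := Sum.inr AReg.x) (by simp) _)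
  simp only [state, Sum.elim_inl, regs_nrev2, Sum.elim_inr, AReg.file_x, List.reverse_reverse, List.append_nil,
    Sum.update_elim_inl, update_regs_nrev2, Sum.update_elim_inr, AReg.update_file_x] at c8
  have c9 := c8.seq (runs_copy (a := (Sum.inr AReg.x : K ⊕ AReg)) (b := Sum.inl K.nb) (t := Sum.inl K.tmp)
    (u := Sum.inr AReg.s) (by simp) (by simp) (by simp) (by simp) (by simp) (by simp) _ (by simp) (by simp))
  have c10 := c9.seq (Runs.push (Sum.inl K.key) true _)
  simp only [Sum.elim_inr, AReg.file_x, Sum.elim_inl, regs_nb, Sum.update_elim_inl, update_regs_nb, regs_key,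
    update_regs_key] at c10
  have c11 := c10.seq (runs_memWrite _ _ (encodeNat 1) (encodeNat n) [] [] [] [] [] [] [] rfl (by simp [e1])
    (by simp))
  refine c11.of_eq ?_ ?_
  · simp [state, St.zero]
  · have l1 := Brick.length_encodeNat_mono (Nat.sub_le A 1)
    simp only [List.length_nil, List.length_reverse, TokConv.encodeNat_zero', hlen, e1, List.length_singleton]
    omega

/-- Entries `2 ↦ m + 1` (the number of clauses of the padded formula) and `3 ↦ 2` (the length of the
padding clause). [folklore] -/
def hdrE23 : Com (K ⊕ AReg) :=
  (((((incr (Sum.inl K.mc) (Sum.inl K.it1) (Sum.inl K.it2) (Sum.inl K.ifl) ;;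
    move (Sum.inl K.mc) (Sum.inr AReg.x) (Sum.inl K.tmp)) ;; pushNum (Sum.inl K.key) (encodeNat 2)) ;; memWrite) ;;
    pushNum (Sum.inr AReg.x) (encodeNat 2)) ;; pushNum (Sum.inl K.key) (encodeNat 3)) ;; memWrite

/-- Effect of `hdrE23`. [folklore] -/
theorem runs_hdrE23 (A m T n : ℕ) (e : Bool) (E : List (List Bool × List Bool)) :
    Runs hdrE23
      (state { St.zero with
        nrev := (encodeNat n).reverse, nb := encodeNat n, tokc := ones T
        adr := encodeNat A, mc := encodeNat m, he := flag e, mem := encLog E } F0)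
      (state { St.zero with
        nrev := (encodeNat n).reverse, nb := encodeNat n, tokc := ones T
        adr := encodeNat A, he := flag e
        mem := encLog ((encodeNat 3, encodeNat 2) :: (encodeNat 2, encodeNat (m + 1)) :: E) } F0)
      (22 * (encodeNat (m + 1)).length + 9 * (encodeNat m).length + 80) := by
  have e2 : (encodeNat 2).length = 2 := by decide
  have e3 : (encodeNat 3).length = 2 := by decide
  have c1 := runs_incr (B := (Sum.inl K.mc : K ⊕ AReg)) (t := Sum.inl K.it1) (t2 := Sum.inl K.it2) (fl := Sum.inl K.ifl)
    (by simp) (by simp) (by simp) (by simp) (by simp) (by simp)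
    (state { St.zero with
      nrev := (encodeNat n).reverse, nb := encodeNat n, tokc := ones T
      adr := encodeNat A, mc := encodeNat m, he := flag e, mem := encLog E } F0)
    (by simp [state, St.zero]) (by simp [state, St.zero]) (by simp [state, St.zero])
  simp only [state, Sum.elim_inl, regs_mc, ← TokConv.encodeNat_succ_eq_incRes, Sum.update_elim_inl, update_regs_mc] at c1
  have c2 := c1.seq (runs_move (a := (Sum.inl K.mc : K ⊕ AReg)) (b := Sum.inr AReg.x) (t := Sum.inl K.tmp) (by simp)
    (by simp) (by simp) _ (by simp [St.zero]))
  have c3 := c2.seq (runs_pushNum (Sum.inl K.key : K ⊕ AReg) (encodeNat 2) _)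
  simp only [Sum.elim_inl, regs_mc, Sum.elim_inr, AReg.file_x, List.append_nil, Sum.update_elim_inl, update_regs_mc,
    Sum.update_elim_inr, AReg.update_file_x, regs_key, update_regs_key] at c3
  have c4 := c3.seq (runs_memWrite _ E (encodeNat 2) (encodeNat (m + 1)) [] [] [] [] [] [] [] (by simp)
    (by simp [St.zero]) (by simp [St.zero]))
  have c5 := c4.seq (runs_pushNum (Sum.inr AReg.x : K ⊕ AReg) (encodeNat 2) _)
  have c6 := c5.seq (runs_pushNum (Sum.inl K.key : K ⊕ AReg) (encodeNat 3) _)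
  simp only [state, Sum.elim_inr, AReg.file_x, List.append_nil, Sum.update_elim_inr, AReg.update_file_x, Sum.elim_inl,
    regs_key, Sum.update_elim_inl, update_regs_key] at c6
  have c7 := c6.seq (runs_memWrite _ _ (encodeNat 3) (encodeNat 2) [] [] [] [] [] [] [] rfl rfl rfl)
  refine c7.of_eq ?_ ?_
  · simp [state, St.zero]
  · simp only [e2, e3]
    omega

/-- Entries `4 ↦ 2(n-1) + 1` and `5 ↦ 2(n-1)`: the literals `x_{n-1}`, `¬x_{n-1}` of the padding
clause (`n - 1` by one subtraction on a copy of `nb`, normalised; the two literal codes by one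
more low bit). [folklore] -/
def hdrE45 : Com (K ⊕ AReg) :=
  (((((((((((((copy (Sum.inl K.nb) (Sum.inr AReg.x) (Sum.inl K.tmp) (Sum.inr AReg.s) ;; push (Sum.inr AReg.y) true) ;;
    bk sub) ;; clear (Sum.inr AReg.g)) ;; clear (Sum.inr AReg.y)) ;; bk normalize) ;;
    copy (Sum.inr AReg.x) (Sum.inl K.a0) (Sum.inl K.tmp) (Sum.inr AReg.s)) ;; push (Sum.inr AReg.x) true) ;;
    pushNum (Sum.inl K.key) (encodeNat 4)) ;; memWrite) ;;
    move (Sum.inl K.a0) (Sum.inr AReg.x) (Sum.inl K.tmp)) ;; push (Sum.inr AReg.x) false) ;; bk normalize) ;;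
    pushNum (Sum.inl K.key) (encodeNat 5)) ;; memWrite

/-- `norm (x mod ...)`: the subtraction of `1` followed by normalisation gives `n - 1` (also for
`n = 0`, where the borrow leaves `x` unchanged). [folklore] -/
theorem norm_sub_one (n : ℕ) :
    norm (bif subBorrow (encodeNat n) [true] then encodeNat n else subRes (encodeNat n) [true]) = encodeNat (n - 1) := by
  rw [subBorrow_iff, bitsToNat_encodeNat]
  rcases Nat.eq_zero_or_pos n with rfl | hn
  · simp [TokConv.encodeNat_zero']
  · have : ¬ n < bitsToNat [true] := by simp; omega
    rw [decide_eq_false this]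
    simp only [cond_false]
    rw [norm_eq_encodeNat, bitsToNat_subRes _ _ (by rw [bitsToNat_encodeNat]; simp; omega), bitsToNat_encodeNat]
    rfl

/-- The two literal codes are canonical: `norm (1 :: encodeNat v) = encodeNat (2v + 1)`,
`norm (0 :: encodeNat v) = encodeNat (2v)`. [folklore] -/
theorem norm_cons_encodeNat (b : Bool) (v : ℕ) : norm (b :: encodeNat v) = encodeNat (2 * v + b.toNat) := by
  rw [norm_eq_encodeNat, bitsToNat_cons, bitsToNat_encodeNat]; congr 1; omega

/-- Effect of `hdrE45`. [folklore] -/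
theorem runs_hdrE45 (A T n : ℕ) (e : Bool) (E : List (List Bool × List Bool)) :
    Runs hdrE45
      (state { St.zero with
        nrev := (encodeNat n).reverse, nb := encodeNat n, tokc := ones T
        adr := encodeNat A, he := flag e, mem := encLog E } F0)
      (state { St.zero with
        nrev := (encodeNat n).reverse, nb := encodeNat n, tokc := ones T
        adr := encodeNat A, he := flag e
        mem := encLog ((encodeNat 5, encodeNat (2 * (n - 1))) :: (encodeNat 4, encodeNat (2 * (n - 1) + 1)) :: E) } F0)
      (90 * (encodeNat n).length + 150) := by
  have e4 : (encodeNat 4).length = 3 := by decide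
  have e5 : (encodeNat 5).length = 3 := by decide
  have ld : (bif subBorrow (encodeNat n) [true] then encodeNat n else subRes (encodeNat n) [true]).length =
      (encodeNat n).length := by cases subBorrow (encodeNat n) [true] <;> simp [length_subRes]
  have lsub : (encodeNat (n - 1)).length ≤ (encodeNat n).length := Brick.length_encodeNat_mono (Nat.sub_le n 1)
  have c1 := runs_copy (a := (Sum.inl K.nb : K ⊕ AReg)) (b := Sum.inr AReg.x) (t := Sum.inl K.tmp) (u := Sum.inr AReg.s)
    (by simp) (by simp) (by simp) (by simp) (by simp) (by simp)
    (state { St.zero with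
      nrev := (encodeNat n).reverse, nb := encodeNat n, tokc := ones T
      adr := encodeNat A, he := flag e, mem := encLog E } F0) (by simp [state, St.zero]) (by simp [state])
  have c2 := c1.seq (Runs.push (Sum.inr AReg.y) true _)
  simp only [state, Sum.elim_inl, regs_nb, Sum.elim_inr, AReg.file_x, List.append_nil, Sum.update_elim_inr,
    AReg.update_file_x, AReg.file_y, AReg.update_file_y] at c2
  have c3 := c2.seq ((runs_sub (encodeNat n) [true] []).inr _)
  have c4 := c3.seq (runs_clear_flag (Sum.inr AReg.g : K ⊕ AReg) (by simp [length_flag_le]))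
  have c5 := c4.seq (runs_clear (Sum.inr AReg.y : K ⊕ AReg) _)
  simp only [Sum.update_elim_inr, AReg.update_file_g, Sum.elim_inr, AReg.file_y, AReg.update_file_y,
    List.length_singleton] at c5
  have c6 := c5.seq ((runs_normalize _ [] [] [] [] []).inr _)
  rw [norm_sub_one] at c6
  have c7 := c6.seq (runs_copy (a := (Sum.inr AReg.x : K ⊕ AReg)) (b := Sum.inl K.a0) (t := Sum.inl K.tmp)
    (u := Sum.inr AReg.s) (by simp) (by simp) (by simp) (by simp) (by simp) (by simp) _ (by simp [St.zero]) (by simp))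
  have c8 := (c7.seq (Runs.push (Sum.inr AReg.x) true _)).seq (runs_pushNum (Sum.inl K.key : K ⊕ AReg) (encodeNat 4) _)
  simp only [Sum.elim_inr, AReg.file_x, Sum.elim_inl, regs_a0, Sum.update_elim_inl, update_regs_a0, Sum.update_elim_inr,
    AReg.update_file_x, regs_key, update_regs_key] at c8
  have c9 := c8.seq (runs_memWrite _ E (encodeNat 4) (true :: encodeNat (n - 1)) [] [] [] [] [] [] [] (by simp)
    (by simp [St.zero]) (by simp [St.zero]))
  have c10 := c9.seq (runs_move (a := (Sum.inl K.a0 : K ⊕ AReg)) (b := Sum.inr AReg.x) (t := Sum.inl K.tmp) (by simp)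
    (by simp) (by simp) _ (by simp [St.zero]))
  have c10' := c10.seq (Runs.push (Sum.inr AReg.x) false _)
  simp only [state, Sum.elim_inl, regs_a0, Sum.elim_inr, AReg.file_x, zero_a0, List.append_nil, Sum.update_elim_inl,
    update_regs_a0, Sum.update_elim_inr, AReg.update_file_x] at c10'
  have c11 := c10'.seq ((runs_normalize (false :: encodeNat (n - 1)) [] [] [] [] []).inr _)
  have c12 := c11.seq (runs_pushNum (Sum.inl K.key : K ⊕ AReg) (encodeNat 5) _)
  simp only [Sum.elim_inl, Sum.update_elim_inl, regs_key, update_regs_key, norm_cons_encodeNat,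
    Bool.toNat_false, add_zero, List.append_nil] at c12
  have c13 := c12.seq (runs_memWrite _ _ (encodeNat 5) (encodeNat (2 * (n - 1))) [] [] [] [] [] [] [] rfl rfl rfl)
  refine c13.of_eq ?_ ?_
  · have ev : true :: encodeNat (n - 1) = encodeNat (2 * (n - 1) + 1) := by
      have hn := norm_cons_encodeNat true (n - 1)
      simp only [Bool.toNat_true] at hn
      rw [← hn]
      refine eq_of_bitsToNat_eq_of_canonical (true :: encodeNat (n - 1)) (norm (true :: encodeNat (n - 1))) ?_
        (norm_eq_nil_or_getLast _) (by simp)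
      rcases encodeNat_canonical (n - 1) with h | ⟨v, hv⟩
      · exact Or.inr ⟨[], by rw [h]; rfl⟩
      · exact Or.inr ⟨true :: v, by rw [hv]; rfl⟩
    simp [state, St.zero, ev]
  · have l2 : (encodeNat (2 * (n - 1))).length ≤ (encodeNat (n - 1)).length + 1 := by
      have hn := norm_cons_encodeNat false (n - 1)
      simp only [Bool.toNat_false, add_zero] at hn
      rw [← hn]
      exact (length_norm_le _).trans (by simp)
    simp only [e4, e5, List.length_cons, ld]
    omega

/-! ### After the token loop: the ruler of the word size -/

/-- `k` copies of the counter `cn` onto the ruler `wr`. [folklore] -/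
def repCopy : ℕ → Com (K ⊕ AReg)
  | 0 => skip
  | k + 1 => repCopy k ;; copy (Sum.inl K.cn) (Sum.inl K.wr) (Sum.inl K.tmp) (Sum.inr AReg.s)

/-- Effect of `repCopy k`: `wr := 1^{k U} ++ wr` for `cn = 1^U`. [folklore] -/
theorem runs_repCopy (U : ℕ) : ∀ (k : ℕ) (ρ : St), ρ.cn = ones U → ρ.tmp = [] →
    Runs (repCopy k) (state ρ F0) (state { ρ with wr := ones (k * U) ++ ρ.wr } F0) (k * (10 * U + 3))
  | 0, ρ, _, _ => (Runs.skip _).of_eq (by simp [state]) (by simp)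
  | k + 1, ρ, hcn, htmp => by
    have h1 := runs_repCopy U k ρ hcn htmp
    have h2 := h1.seq (runs_copy (a := (Sum.inl K.cn : K ⊕ AReg)) (b := Sum.inl K.wr) (t := Sum.inl K.tmp)
      (u := Sum.inr AReg.s) (by simp) (by simp) (by simp) (by simp) (by simp) (by simp) _ (by simp [state, htmp]) (by simp [state]))
    simp only [state, Sum.elim_inl, regs_cn, regs_wr, Sum.update_elim_inl, update_regs_wr] at h2
    refine h2.of_eq ?_ (by rw [hcn]; simp; ring_nf; omega)
    rw [hcn]
    simp only [state, ← List.append_assoc, ones_append, Nat.succ_mul]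
    congr 3; ring

/-- `buildRuler kW`: `n` in unary from the header bits (Horner), plus the token count plus one;
`kW` copies of that make the ruler. [folklore] -/
def buildRuler (kW : ℕ) : Com (K ⊕ AReg) :=
  ((((move (Sum.inl K.nrev) (Sum.inl K.scr) (Sum.inl K.tmp) ;; hornerLoop wregs) ;;
    move (Sum.inl K.tokc) (Sum.inl K.cn) (Sum.inl K.tmp)) ;; push (Sum.inl K.cn) true) ;; repCopy kW) ;; clear (Sum.inl K.cn)

/-- Effect of `buildRuler`: `wr := 1^{kW (T + n + 1)}`, `nrev` and `tokc` consumed. [folklore] -/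
theorem runs_buildRuler (kW A T n : ℕ) (e : Bool) (E : List (List Bool × List Bool)) :
    Runs (buildRuler kW)
      (state { St.zero with
        nrev := (encodeNat n).reverse, nb := encodeNat n, tokc := ones T, adr := encodeNat A, he := flag e
        mem := encLog E } F0)
      (state { St.zero with
        nb := encodeNat n, adr := encodeNat A, he := flag e, mem := encLog E, wr := ones (kW * (T + n + 1)) } F0)
      ((encodeNat n).length * (20 * n + 11) + (kW + 1) * (10 * (T + n + 1) + 3) + 6 * T + 10) := by
  have hmsb : UnLeBin.msbVal 0 (encodeNat n).reverse = n := by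
    rw [UnLeBin.msbVal_reverse, bitsToNat_encodeNat]; simp
  have c1 := runs_move (a := (Sum.inl K.nrev : K ⊕ AReg)) (b := Sum.inl K.scr) (t := Sum.inl K.tmp) (by simp) (by simp)
    (by simp)
    (state { St.zero with
      nrev := (encodeNat n).reverse, nb := encodeNat n, tokc := ones T, adr := encodeNat A, he := flag e
      mem := encLog E } F0) (by simp [state, St.zero])
  simp only [state, Sum.elim_inl, regs_nrev, regs_scr, zero_scr, List.append_nil, Sum.update_elim_inl, update_regs_nrev,
    update_regs_scr] at c1
  have c2 := c1.seq (runs_hornerLoop wregs (κ := K) (encodeNat n).reverse _ 0 n [] [] [] [] [] [] [] (by rfl)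
    (by simp [wregs, St.zero]) (by rw [hmsb]))
  rw [hmsb] at c2
  simp only [wregs, update_regs_scr, update_regs_cn, List.length_reverse] at c2
  have c3 := c2.seq (runs_move (a := (Sum.inl K.tokc : K ⊕ AReg)) (b := Sum.inl K.cn) (t := Sum.inl K.tmp) (by simp)
    (by simp) (by simp) _ (by simp [St.zero]))
  have c4 := c3.seq (Runs.push (Sum.inl K.cn) true _)
  simp only [Sum.elim_inl, regs_tokc, regs_cn, ones_append, Sum.update_elim_inl, update_regs_tokc, update_regs_cn,
    List.length_replicate] at c4
  have c5 := c4.seq (runs_repCopy (T + n + 1) kW _ (by simp [ones, List.replicate_succ]) (by simp [St.zero]))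
  have c6 := c5.seq (runs_clear (Sum.inl K.cn : K ⊕ AReg) _)
  simp only [state, Sum.elim_inl, regs_cn, Sum.update_elim_inl, update_regs_cn, List.length_cons, List.length_replicate]
    at c6
  refine c6.of_eq ?_ ?_
  · simp [state, St.zero]
  · ring_nf; omega

/-! ### After the token loop: everything together -/

/-- The log entries of the header of the RAM input `x = encodeCNFWords (pad φ)`: `0 ↦ |x| = A - 1`,
`1 ↦ n`, `2 ↦ m + 1`, `3 ↦ 2`, `4 ↦ 2(n-1)+1`, `5 ↦ 2(n-1)` (newest first). [folklore] -/
def hdrLog (n m A : ℕ) : List (List Bool × List Bool) :=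
  [(encodeNat 5, encodeNat (2 * (n - 1))), (encodeNat 4, encodeNat (2 * (n - 1) + 1)), (encodeNat 3, encodeNat 2),
    (encodeNat 2, encodeNat (m + 1)), (encodeNat 1, encodeNat n), (encodeNat 0, encodeNat (A - 1))]

/-- `postPass kW`: the header entries, the ruler, the run flag; the address counter is dropped.
[folklore] -/
def postPass (kW : ℕ) : Com (K ⊕ AReg) :=
  ((((hdrE01 ;; hdrE23) ;; hdrE45) ;; buildRuler kW) ;; push (Sum.inl K.run) true) ;; clear (Sum.inl K.adr)

/-- A uniform bound of the cost of `postPass`. [folklore] -/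
def postCost (kW n m A T : ℕ) : ℕ :=
  72 * (encodeNat A).length + 114 * (encodeNat n).length + 22 * (encodeNat (m + 1)).length + 9 * (encodeNat m).length +
    (encodeNat n).length * (20 * n + 11) + (kW + 1) * (10 * (T + n + 1) + 3) + 6 * T + 322

/-- **Effect of `postPass`** from the end of a well-formed token pass (`A ≥ 1`): the log gains the
header entries, the ruler holds `1^{kW (T + n + 1)}`, `nb` holds `encodeNat n`, the run flag is
armed, and only `he` survives of the front-end registers. [folklore] -/
theorem runs_postPass (kW A m T n : ℕ) (hA : 1 ≤ A) (e : Bool) (E : List (List Bool × List Bool)) :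
    Runs (postPass kW)
      (state { St.zero with
        nrev := (encodeNat n).reverse, nrev2 := (encodeNat n).reverse, tokc := ones T
        adr := encodeNat A, mc := encodeNat m, he := flag e, mem := encLog E } F0)
      (state { St.zero with
        nb := encodeNat n, he := flag e, mem := encLog (hdrLog n m A ++ E), wr := ones (kW * (T + n + 1))
        run := [true] } F0)
      (postCost kW n m A T) := by
  have c1 := runs_hdrE01 A m T n hA e E
  have c2 := c1.seq (runs_hdrE23 A m T n e _)
  have c3 := c2.seq (runs_hdrE45 A T n e _)
  have c4 := c3.seq (runs_buildRuler kW A T n e _)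
  have c5 := c4.seq (Runs.push (Sum.inl K.run) true _)
  have c6 := c5.seq (runs_clear (Sum.inl K.adr : K ⊕ AReg) _)
  simp only [state, Sum.elim_inl, regs_run, zero_run, Sum.update_elim_inl, update_regs_run, regs_adr, update_regs_adr]
    at c6
  refine c6.of_eq ?_ ?_
  · simp [state, St.zero, hdrLog]
  · unfold postCost
    omega

/-! ### The token pass as a function of the clause list -/

/-- The pass over one literal `(w, b)` (index bits `w`, polarity `b`), functionally. [folklore] -/
def litPass (s : FS) (b : Bool) (w : List Bool) : FS :=
  { polStep s b with
    E := (encodeNat (polStep s b).A, norm (b :: w)) :: s.E, A := (polStep s b).A + 1, c := (polStep s b).c + 1, lit := []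
    T := (polStep s b).T + w.length + 1 }

/-- The pass over one clause, functionally. [folklore] -/
def clausePass (s : FS) (c : List (List Bool × Bool)) : FS :=
  endcStep (c.foldl (fun s l => litPass s l.2 l.1) s)

/-- The pass over a clause list, functionally. [folklore] -/
def formulaPass (s : FS) (F : List (List (List Bool × Bool))) : FS := F.foldl clausePass s

/-- Bits of a literal are pushed on `lit`. [folklore] -/
theorem foldl_tokStep_bits (w : List Bool) : ∀ (s : FS), s.hm = false →
    (w.map FineGrained.LightSearch.Tok.bit).foldl tokStep s = { s with lit := w.reverse ++ s.lit, T := s.T + w.length } := by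
  induction w with
  | nil => intro s _; cases s; simp
  | cons b w ih =>
    intro s hs
    rw [List.map_cons, List.foldl_cons, show tokStep s (.bit b) = { s with lit := b :: s.lit, T := s.T + 1 } by
      simp [tokStep, hs], ih _ (by simpa using hs)]
    cases s; simp; omega

/-- **The tokens of a literal act as `litPass`.** [folklore] -/
theorem foldl_tokStep_litToks (s : FS) (hs : s.hm = false) (hl : s.lit = []) (w : List Bool) (b : Bool) :
    (litToks (w, b)).foldl tokStep s = litPass s b w := by
  obtain ⟨A, A0, c, m, T, ic, e, lit, E, hm, nr⟩ := s
  simp only at hs hl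
  subst hs hl
  cases ic <;>
    simp only [litToks, List.foldl_cons, List.foldl_append, List.foldl_nil, tokStep, polStep, litPass, endlStep,
      Bool.false_eq_true, ↓reduceIte, foldl_tokStep_bits, List.reverse_append, List.reverse_reverse,
      List.reverse_cons, List.reverse_nil, List.nil_append, List.cons_append]

/-- `litPass` keeps formula mode and an empty literal register. [folklore] -/
theorem litPass_hm_lit (s : FS) (b : Bool) (w : List Bool) : (litPass s b w).hm = (polStep s b).hm ∧ (litPass s b w).lit = [] :=
  ⟨rfl, rfl⟩

/-- `polStep` keeps the mode. [folklore] -/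
theorem polStep_hm (s : FS) (b : Bool) : (polStep s b).hm = s.hm := by unfold polStep; split <;> rfl

/-- **The tokens of a clause act as `clausePass`.** [folklore] -/
theorem foldl_tokStep_clauseToks (c : List (List Bool × Bool)) : ∀ (s : FS), s.hm = false → s.lit = [] →
    (clauseToks c).foldl tokStep s = clausePass s c := by
  suffices hlits : ∀ (s : FS), s.hm = false → s.lit = [] →
      (c.flatMap litToks).foldl tokStep s = c.foldl (fun s l => litPass s l.2 l.1) s ∧
        (c.foldl (fun s l => litPass s l.2 l.1) s).hm = false ∧ (c.foldl (fun s l => litPass s l.2 l.1) s).lit = [] by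
    intro s hs hl
    obtain ⟨h1, h2, -⟩ := hlits s hs hl
    simp only [clauseToks, List.foldl_append, h1, List.foldl_cons, List.foldl_nil, clausePass]
    simp [tokStep, h2]
  induction c with
  | nil => intro s hs hl; exact ⟨rfl, hs, hl⟩
  | cons l c ih =>
    intro s hs hl
    obtain ⟨w, b⟩ := l
    have h1 := foldl_tokStep_litToks s hs hl w b
    have hs' : (litPass s b w).hm = false := by rw [(litPass_hm_lit s b w).1, polStep_hm, hs]
    obtain ⟨ih1, ih2, ih3⟩ := ih (litPass s b w) hs' rfl
    simp only [List.flatMap_cons, List.foldl_append, h1, List.foldl_cons]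
    exact ⟨ih1, ih2, ih3⟩

/-- `clausePass` keeps formula mode and an empty literal register. [folklore] -/
theorem clausePass_hm_lit (c : List (List Bool × Bool)) : ∀ (s : FS), s.hm = false → s.lit = [] →
    (clausePass s c).hm = false ∧ (clausePass s c).lit = [] := by
  suffices h : ∀ (s : FS), s.hm = false → s.lit = [] →
      (c.foldl (fun s l => litPass s l.2 l.1) s).hm = false ∧ (c.foldl (fun s l => litPass s l.2 l.1) s).lit = [] by
    intro s hs hl
    obtain ⟨h1, h2⟩ := h s hs hl
    unfold clausePass endcStep
    split <;> exact ⟨h1, h2⟩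
  induction c with
  | nil => intro s hs hl; exact ⟨hs, hl⟩
  | cons l c ih =>
    intro s hs hl
    have hs' : (litPass s l.2 l.1).hm = false := by rw [(litPass_hm_lit s l.2 l.1).1, polStep_hm, hs]
    exact ih _ hs' rfl

/-- **The tokens of a clause list act as `formulaPass`.** [folklore] -/
theorem foldl_tokStep_formulaToks (F : List (List (List Bool × Bool))) : ∀ (s : FS), s.hm = false → s.lit = [] →
    (formulaToks F).foldl tokStep s = formulaPass s F := by
  induction F with
  | nil => intro s _ _; rfl
  | cons c F ih =>
    intro s hs hl
    rw [FineGrained.LightSearch.formulaToks_cons, List.foldl_append, foldl_tokStep_clauseToks c s hs hl, formulaPass, List.foldl_cons]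
    obtain ⟨h1, h2⟩ := clausePass_hm_lit c s hs hl
    exact ih _ h1 h2

/-- **The header tokens** collect the bits of `n` (last on top) and leave header mode. [folklore] -/
theorem foldl_tokStep_hdrToks (n : ℕ) (s : FS) (hs : s.hm = true) :
    (hdrToks n).foldl tokStep s =
      { s with nr := (encodeNat n).reverse ++ s.nr, hm := false, T := s.T + (encodeNat n).length + 1 } := by
  have key : ∀ (w : List Bool) (s : FS), s.hm = true →
      (w.map FineGrained.LightSearch.Tok.bit).foldl tokStep s = { s with nr := w.reverse ++ s.nr, T := s.T + w.length } := by
    intro w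
    induction w with
    | nil => intro s _; cases s; simp
    | cons b w ih =>
      intro s hs
      rw [List.map_cons, List.foldl_cons, show tokStep s (.bit b) = { s with nr := b :: s.nr, T := s.T + 1 } by
        simp [tokStep, hs], ih _ (by simpa using hs)]
      cases s; simp; omega
  obtain ⟨A, A0, c, m, T, ic, e, lit, E, hm, nr⟩ := s
  simp only at hs
  subst hs
  simp only [hdrToks, List.foldl_append]
  rw [key (encodeNat n) ⟨A, A0, c, m, T, ic, e, lit, E, true, nr⟩ rfl]
  simp [tokStep]


/-! ### Segment logs -/

/-- The log entries of the cells `A, A + 1, …` holding the words `vs`, lowest address first.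
[folklore] -/
def segLog : ℕ → List ℕ → List (List Bool × List Bool)
  | _, [] => []
  | A, v :: vs => (encodeNat A, encodeNat v) :: segLog (A + 1) vs

/-- `segLog` of no word. [folklore] -/
@[simp] theorem segLog_nil (A : ℕ) : segLog A [] = [] := rfl

/-- `segLog` of a cons. [folklore] -/
@[simp] theorem segLog_cons (A v : ℕ) (vs : List ℕ) :
    segLog A (v :: vs) = (encodeNat A, encodeNat v) :: segLog (A + 1) vs := rfl

/-- `segLog` of a concatenation. [folklore] -/
theorem segLog_append (us vs : List ℕ) : ∀ A : ℕ, segLog A (us ++ vs) = segLog A us ++ segLog (A + us.length) vs := by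
  induction us with
  | nil => intro A; simp
  | cons u us ih =>
    intro A
    rw [List.cons_append, segLog_cons, segLog_cons, ih, List.cons_append, List.length_cons,
      show A + 1 + us.length = A + (us.length + 1) by omega]

/-- `segLog` has one entry per word. [folklore] -/
theorem length_segLog (vs : List ℕ) : ∀ A : ℕ, (segLog A vs).length = vs.length := by
  induction vs with
  | nil => intro A; rfl
  | cons v vs ih => intro A; simp [ih]

/-- The keys of `segLog A vs` are the numerals of `A, …, A + |vs| - 1`. [folklore] -/
theorem map_fst_segLog (vs : List ℕ) : ∀ A : ℕ, (segLog A vs).map Prod.fst = (List.range' A vs.length).map encodeNat := by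
  induction vs with
  | nil => intro A; rfl
  | cons v vs ih => intro A; simp [List.range'_succ, ih]

/-- The keys of a segment log are pairwise distinct. [folklore] -/
theorem nodup_map_fst_segLog (A : ℕ) (vs : List ℕ) : ((segLog A vs).map Prod.fst).Nodup := by
  rw [map_fst_segLog]
  exact List.Nodup.map (fun a b h => encodeNat_eq_encodeNat_iff.1 h) (List.nodup_range' (step := 1))

/-- The entry of the `i`-th word. [folklore] -/
theorem getElem_mem_segLog (vs : List ℕ) : ∀ (A i : ℕ) (h : i < vs.length),
    (encodeNat (A + i), encodeNat vs[i]) ∈ segLog A vs := by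
  induction vs with
  | nil => intro A i h; simp at h
  | cons v vs ih =>
    intro A i h
    cases i with
    | zero => simp
    | succ i =>
      have := ih (A + 1) i (by simpa using h)
      rw [show A + 1 + i = A + (i + 1) by omega] at this
      simp only [segLog_cons, List.mem_cons, List.getElem_cons_succ]
      exact Or.inr this

/-- Every entry of a segment log is the numeral of an address below `A + |vs|` with the numeral
of a word of `vs`. [folklore] -/
theorem exists_of_mem_segLog (vs : List ℕ) : ∀ (A : ℕ) {e : List Bool × List Bool}, e ∈ segLog A vs →
    ∃ a v, a < A + vs.length ∧ v ∈ vs ∧ e = (encodeNat a, encodeNat v) := by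
  induction vs with
  | nil => intro A e h; simp at h
  | cons u vs ih =>
    intro A e h
    simp only [segLog_cons, List.mem_cons] at h
    rcases h with rfl | h
    · exact ⟨A, u, by simp, by simp, rfl⟩
    · obtain ⟨a, v, ha, hv, rfl⟩ := ih (A + 1) h
      exact ⟨a, v, by simp at ha ⊢; omega, by simp [hv], rfl⟩

/-- **Lookup in a permuted segment log based at `0`** reads the word list (zero beyond it).
[folklore] -/
theorem logLookup_of_perm_segLog {E : List (List Bool × List Bool)} {ws : List ℕ} (h : E.Perm (segLog 0 ws)) (a : ℕ) :
    logLookup E (encodeNat a) = encodeNat (ws.getD a 0) := by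
  have hnd : (E.map Prod.fst).Nodup := (h.map Prod.fst).nodup_iff.2 (nodup_map_fst_segLog 0 ws)
  by_cases ha : a < ws.length
  · have hm : (encodeNat a, encodeNat ws[a]) ∈ E := h.symm.subset (by simpa using getElem_mem_segLog ws 0 a ha)
    rw [logLookup_of_mem_of_nodup hnd hm, List.getD_eq_getElem _ _ ha]
  · have hk : encodeNat a ∉ E.map Prod.fst := by
      intro hin
      have h' := (h.map Prod.fst).subset hin
      rw [map_fst_segLog] at h'
      obtain ⟨b, hb, hba⟩ := List.mem_map.1 h'
      rw [encodeNat_eq_encodeNat_iff] at hba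
      subst hba
      simp at hb
      omega
    rw [logLookup_of_not_mem hk, List.getD_eq_default _ _ (not_lt.1 ha)]
    decide

/-- A permuted segment log whose addresses and words are at most `V` is `|encodeNat V|`-bounded.
[folklore] -/
theorem boundedLog_of_perm_segLog {E : List (List Bool × List Bool)} {ws : List ℕ} (h : E.Perm (segLog 0 ws)) {V : ℕ}
    (hl : ws.length ≤ V + 1) (hw : ∀ v ∈ ws, v ≤ V) : BoundedLog (encodeNat V).length E := by
  intro e he
  obtain ⟨a, v, ha, hv, rfl⟩ := exists_of_mem_segLog ws 0 (h.subset he)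
  exact ⟨Brick.length_encodeNat_mono (by omega), Brick.length_encodeNat_mono (hw v hv)⟩

/-- **The initial memory of the word RAM** on an input whose length and entries fit in a word is
the word list `|x| :: x` (zero beyond). [folklore] -/
theorem init_mem_eq_getD (W : ℕ) (x : List ℕ) (hx : ∀ v ∈ x, v < 2 ^ W) (hl : x.length < 2 ^ W) (a : ℕ) :
    (Literature.Computability.Cryptography.WordRAM.init W x).mem a = (x.length :: x).getD a 0 := by
  rcases a with _ | i
  · rw [Literature.Computability.Cryptography.WordRAM.init_mem_zero, Nat.mod_eq_of_lt hl]; rfl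
  · by_cases hi : i < x.length
    · rw [Literature.Computability.Cryptography.WordRAM.init_mem_succ W x i hi, Nat.mod_eq_of_lt (hx _ (List.getElem_mem hi))]
      simp [hi]
    · rw [Literature.Computability.Cryptography.WordRAM.init_mem_of_length_lt W x (i + 1) (by omega)]
      simp [List.getElem?_eq_none_iff.2 (not_lt.1 hi)]

/-! ### The words of a coded clause list -/

/-- The word of a coded literal `(w, b)`: `2 · val(w) + b`. [folklore] -/
def litWord (l : List Bool × Bool) : ℕ := bitsToNat (l.2 :: l.1)

/-- The words of a coded clause: its length, then its literals; an empty clause has no words (the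
front end only raises the empty-clause flag on it). [folklore] -/
def clauseWords (c : Clause (List Bool)) : List ℕ := if c = [] then [] else c.length :: c.map litWord

/-- The words of a coded clause list. [folklore] -/
def dataWords (F : CNF (List Bool)) : List ℕ := F.flatMap clauseWords

/-- `dataWords` of a cons. [folklore] -/
@[simp] theorem dataWords_cons (c : Clause (List Bool)) (F : CNF (List Bool)) :
    dataWords (c :: F) = clauseWords c ++ dataWords F := by simp [dataWords]

/-- `dataWords` of nil. [folklore] -/
@[simp] theorem dataWords_nil : dataWords [] = [] := rfl

/-- The value written by `litPass` is the numeral of the literal's word. [folklore] -/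
theorem norm_cons_eq_litWord (b : Bool) (w : List Bool) : norm (b :: w) = encodeNat (litWord (w, b)) := by
  rw [norm_eq_encodeNat]; rfl

/-! ### The token pass, clause by clause -/

/-- The number of tokens of the literals of a coded clause (without its `endc`). [folklore] -/
def tokLen (c : Clause (List Bool)) : ℕ := (c.map fun l => l.1.length + 2).sum

/-- `tokLen` of a cons. [folklore] -/
@[simp] theorem tokLen_cons (l : List Bool × Bool) (c : Clause (List Bool)) : tokLen (l :: c) = l.1.length + 2 + tokLen c := by
  simp [tokLen]

/-- `tokLen` of nil. [folklore] -/
@[simp] theorem tokLen_nil : tokLen [] = 0 := rfl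

/-- The literals of an open clause, functionally: addresses and literal count advance, the
entries pile up. [folklore] -/
theorem foldl_litPass (ls : List (List Bool × Bool)) : ∀ (s : FS), s.ic = true → s.lit = [] →
    ls.foldl (fun s l => litPass s l.2 l.1) s =
      { s with A := s.A + ls.length, c := s.c + ls.length, T := s.T + tokLen ls
               E := (segLog s.A (ls.map litWord)).reverse ++ s.E } := by
  induction ls with
  | nil => intro s _ _; cases s; simp
  | cons l ls ih =>
    intro s hic hl
    obtain ⟨A, A0, c, m, T, ic, e, lit, E, hm, nr⟩ := s
    simp only at hic hl
    subst hic hl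
    have h1 : litPass ⟨A, A0, c, m, T, true, e, [], E, hm, nr⟩ l.2 l.1 =
        ⟨A + 1, A0, c + 1, m, T + (l.1.length + 2), true, e, [], (encodeNat A, encodeNat (litWord l)) :: E, hm, nr⟩ := by
      simp only [litPass, polStep, ↓reduceIte, norm_cons_eq_litWord, FS.mk.injEq, and_true, true_and]
      omega
    rw [List.foldl_cons, h1, ih _ rfl rfl]
    simp only [List.length_cons, List.map_cons, tokLen_cons, segLog_cons, List.reverse_cons, List.append_assoc,
      List.singleton_append, FS.mk.injEq, and_true, true_and]
    omega

/-- **One clause, functionally**: an empty clause raises the flag; a nonempty one writes its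
length and literals at consecutive addresses and is counted. [folklore] -/
theorem clausePass_eq (cl : Clause (List Bool)) (s : FS) (hic : s.ic = false) (hA0 : s.A0 = 0) (hc : s.c = 0)
    (hl : s.lit = []) :
    clausePass s cl =
      if cl = [] then { s with e := true, T := s.T + 1 }
      else { s with A := s.A + cl.length + 1, m := s.m + 1, T := s.T + tokLen cl + 1
                    E := (encodeNat s.A, encodeNat cl.length) :: ((segLog (s.A + 1) (cl.map litWord)).reverse ++ s.E) } := by
  obtain ⟨A, A0, c, m, T, ic, e, lit, E, hm, nr⟩ := s
  simp only at hic hA0 hc hl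
  subst hic hA0 hc hl
  cases cl with
  | nil => simp [clausePass, endcStep]
  | cons l ls =>
    have h1 : litPass ⟨A, 0, 0, m, T, false, e, [], E, hm, nr⟩ l.2 l.1 =
        ⟨A + 2, A, 1, m, T + (l.1.length + 2), true, e, [], (encodeNat (A + 1), encodeNat (litWord l)) :: E, hm, nr⟩ := by
      simp only [litPass, polStep, Bool.false_eq_true, ↓reduceIte, norm_cons_eq_litWord, FS.mk.injEq, and_true, true_and]
      omega
    simp only [clausePass, List.foldl_cons, h1, reduceCtorEq, ↓reduceIte]
    rw [foldl_litPass ls _ rfl rfl]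
    simp only [endcStep, ↓reduceIte, List.length_cons, List.map_cons, tokLen_cons, segLog_cons, List.reverse_cons,
      List.append_assoc, List.singleton_append, FS.mk.injEq, and_true, true_and]
    refine ⟨by omega, by omega, ?_⟩
    rw [show A + 2 = A + 1 + 1 by omega, Nat.add_comm 1 ls.length]

/-- **The whole clause list, functionally** (from a state between clauses): the final address,
clause count, flag, and — up to the order of entries — the log. [folklore] -/
theorem formulaPass_spec (F : CNF (List Bool)) : ∀ (s : FS), s.ic = false → s.A0 = 0 → s.c = 0 → s.lit = [] →
    (formulaPass s F).ic = false ∧ (formulaPass s F).A0 = 0 ∧ (formulaPass s F).c = 0 ∧ (formulaPass s F).lit = [] ∧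
    (formulaPass s F).hm = s.hm ∧ (formulaPass s F).nr = s.nr ∧
    (formulaPass s F).A = s.A + (dataWords F).length ∧
    (formulaPass s F).m = s.m + (F.filter fun c => c ≠ []).length ∧
    (formulaPass s F).e = (s.e || decide ([] ∈ F)) ∧
    (formulaPass s F).E.Perm (segLog s.A (dataWords F) ++ s.E) := by
  induction F with
  | nil => intro s h1 h2 h3 h4; simp [formulaPass, h1, h2, h3, h4]
  | cons cl F ih =>
    intro s hic hA0 hc hl
    rw [formulaPass, List.foldl_cons, ← formulaPass, clausePass_eq cl s hic hA0 hc hl]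
    obtain ⟨A, A0, c, m, T, ic, e, lit, E, hm, nr⟩ := s
    simp only at hic hA0 hc hl
    subst hic hA0 hc hl
    by_cases hcl : cl = []
    · subst hcl
      simp only [↓reduceIte]
      obtain ⟨i1, i2, i3, i4, i5, i6, i7, i8, i9, i10⟩ := ih ⟨A, 0, 0, m, T + 1, false, true, [], E, hm, nr⟩ rfl rfl rfl rfl
      refine ⟨i1, i2, i3, i4, i5, i6, ?_, ?_, ?_, ?_⟩
      · rw [i7]; simp [clauseWords]
      · rw [i8]; simp
      · rw [i9]; simp
      · simpa [clauseWords] using i10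
    · simp only [hcl, ↓reduceIte]
      obtain ⟨i1, i2, i3, i4, i5, i6, i7, i8, i9, i10⟩ :=
        ih ⟨A + cl.length + 1, 0, 0, m + 1, T + tokLen cl + 1, false, e, [],
          (encodeNat A, encodeNat cl.length) :: ((segLog (A + 1) (cl.map litWord)).reverse ++ E), hm, nr⟩ rfl rfl rfl rfl
      refine ⟨i1, i2, i3, i4, i5, i6, ?_, ?_, ?_, ?_⟩
      · rw [i7]; simp [clauseWords, hcl]; omega
      · rw [i8]; simp [hcl]; omega
      · rw [i9]; simp [Ne.symm hcl]
      · refine i10.trans ?_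
        simp only [dataWords_cons, clauseWords, hcl, ↓reduceIte, segLog_append, segLog_cons,
          List.length_map, List.append_assoc, List.cons_append]
        rw [show A + 1 + cl.length = A + cl.length + 1 by omega]
        set X := segLog (A + cl.length + 1) (dataWords F)
        set S := segLog (A + 1) (cl.map litWord)
        set hd := (encodeNat A, encodeNat cl.length)
        have hp : (hd :: (S.reverse ++ E)).Perm (hd :: (S ++ E)) :=
          List.Perm.cons _ (List.Perm.append_right _ (List.reverse_perm _))
        have e3 : (hd :: (S ++ E)) ++ X = hd :: (S ++ (E ++ X)) := by simp
        exact ((List.Perm.append_left X hp).trans List.perm_append_comm).trans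
          ((List.Perm.of_eq e3).trans (List.Perm.cons _ (List.Perm.append_left _ List.perm_append_comm)))


/-! ### The whole front end -/

/-- The abstract state at the start of the token loop: header mode, first free address `6`
(cell `0` is the length word, cells `1`–`5` the five header words). [folklore] -/
def fs0 : FS := ⟨6, 0, 0, 0, 0, false, false, [], [], true, []⟩

/-- `frontEnd kW`: set up the address counter and header mode, run the token loop, then the
post-pass (header entries, ruler `1^{kW (T + n + 1)}`, run flag). [folklore] -/
def frontEnd (kW : ℕ) : Com (K ⊕ AReg) :=
  ((pushNum (Sum.inl K.adr) (encodeNat 6) ;; push (Sum.inl K.ph) true) ;; mainLoop) ;; postPass kW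

/-- Every token advances the token counter by one. [folklore] -/
theorem T_tokStep (s : FS) (t : FineGrained.LightSearch.Tok) : (tokStep s t).T = s.T + 1 := by
  cases t <;> simp only [tokStep, polStep, endlStep, endcStep] <;> (try split) <;> (try split) <;> rfl

/-- The token counter counts the tokens. [folklore] -/
theorem T_foldl_tokStep (ts : List FineGrained.LightSearch.Tok) : ∀ s : FS, (ts.foldl tokStep s).T = s.T + ts.length := by
  induction ts with
  | nil => intro s; simp
  | cons t ts ih => intro s; rw [List.foldl_cons, ih, T_tokStep, List.length_cons]; omega

/-- The six header words of the memory image: the input length `A - 1`, `n`, the clause count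
`m + 1` of the padded clause list, and the padding clause `x_{n-1} ∨ ¬x_{n-1}` (length `2`,
literal words `2(n-1)+1`, `2(n-1)`). [folklore] -/
def hdrWords (n m A : ℕ) : List ℕ := [A - 1, n, m + 1, 2, 2 * (n - 1) + 1, 2 * (n - 1)]

/-- The header log is the reversed segment log of the header words at `0`. [folklore] -/
theorem hdrLog_eq (n m A : ℕ) : hdrLog n m A = (segLog 0 (hdrWords n m A)).reverse := by
  simp [hdrLog, hdrWords]

/-- The word list `|x| :: x` of the memory image built by the front end on the header `n` and the
coded clause list `F` (`m` = the number of nonempty clauses of `F`). [folklore] -/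
def wordsOf (n : ℕ) (F : CNF (List Bool)) : List ℕ :=
  hdrWords n (F.filter fun c => c ≠ []).length (6 + (dataWords F).length) ++ dataWords F

/-- A clause has fewer words than tokens. [folklore] -/
theorem length_clauseWords_le (c : Clause (List Bool)) : (clauseWords c).length ≤ (clauseToks c).length := by
  unfold clauseWords clauseToks
  split
  · simp
  · simp only [List.length_cons, List.length_map, List.length_append, List.length_flatMap]
    have : c.length ≤ (c.map fun l => (litToks l).length).sum := by
      induction c with
      | nil => simp
      | cons l c ih => simp [litToks] at ih ⊢; omega
    omega

/-- A clause list has fewer words than tokens. [folklore] -/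
theorem length_dataWords_le (F : CNF (List Bool)) : (dataWords F).length ≤ (formulaToks F).length := by
  induction F with
  | nil => simp
  | cons c F ih =>
    have := length_clauseWords_le c
    simp only [dataWords_cons, List.length_append, FineGrained.LightSearch.formulaToks_cons]
    omega

/-- A clause list has fewer nonempty clauses than tokens. [folklore] -/
theorem length_filter_le_formulaToks (F : CNF (List Bool)) :
    (F.filter fun c => c ≠ []).length ≤ (formulaToks F).length := by
  refine (List.length_filter_le _ _).trans ?_
  induction F with
  | nil => simp
  | cons c F ih => simp [clauseToks]; omega

/-- A uniform bound of `postCost` in terms of `kW`, `n` and the token count `T` (`A ≤ T + 6`,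
`m ≤ T`). [folklore] -/
def postCostB (kW n T : ℕ) : ℕ := 109 * T + (n + 1) * (20 * n + 125) + (kW + 1) * (10 * (T + n + 1) + 3) + 900

/-- `postCost ≤ postCostB`. [folklore] -/
theorem postCost_le (kW n m A T : ℕ) (hA : A ≤ T + 6) (hm : m ≤ T) : postCost kW n m A T ≤ postCostB kW n T := by
  have e1 := (TM2Pass.length_encodeNat_le_self A)
  have e2 := (TM2Pass.length_encodeNat_le_self n)
  have e3 := (TM2Pass.length_encodeNat_le_self (m + 1))
  have e4 := (TM2Pass.length_encodeNat_le_self m)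
  unfold postCost postCostB
  have e5 : (encodeNat n).length * (20 * n + 11) ≤ (n + 1) * (20 * n + 11) := Nat.mul_le_mul_right _ e2
  nlinarith [e5]

/-- The cost of the front end on `T` tokens. [folklore] -/
def frontCost (kW n T : ℕ) : ℕ := T * tokCostB (T + 6) + postCostB kW n T + 5

/-- **The front end** on the token code of a header `n` and a coded clause list `F`: it ends with
`n` on `nb`, the empty-clause flag on `he`, the ruler `1^{kW (T + n + 1)}` (`T` the number of
tokens), the run flag armed, and on `mem` a log which is, up to the order of its entries, the
segment log at `0` of the memory image `wordsOf n F`; within `frontCost kW n T` steps. [folklore] -/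
theorem runs_frontEnd (kW n : ℕ) (F : CNF (List Bool)) :
    ∃ E : List (List Bool × List Bool), E.Perm (segLog 0 (wordsOf n F)) ∧ E.length = 6 + (dataWords F).length ∧
      Runs (frontEnd kW) (state { St.zero with inp := bits (hdrToks n ++ formulaToks F) } F0)
        (state { St.zero with
          nb := encodeNat n, he := flag (decide ([] ∈ F)), mem := encLog E
          wr := ones (kW * ((hdrToks n ++ formulaToks F).length + n + 1)), run := [true] } F0)
        (frontCost kW n (hdrToks n ++ formulaToks F).length) := by
  set ts := hdrToks n ++ formulaToks F with hts
  -- the prelude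
  have c1 := runs_pushNum (Sum.inl K.adr : K ⊕ AReg) (encodeNat 6) (state { St.zero with inp := bits ts } F0)
  have c2 := c1.seq (Runs.push (Sum.inl K.ph) true _)
  simp only [state, Sum.elim_inl, regs_adr, zero_adr, List.append_nil, Sum.update_elim_inl, update_regs_adr, regs_ph,
    zero_ph, update_regs_ph] at c2
  have c2' : Runs (pushNum (Sum.inl K.adr) (encodeNat 6) ;; push (Sum.inl K.ph) true)
      (state { St.zero with inp := bits ts } F0) (state (fsSt fs0 (bits ts)) F0) 4 := by
    refine c2.of_eq ?_ (by decide)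
    simp [state, fsSt, fs0, St.zero, flag, ones, TokConv.encodeNat_zero']
  -- the token loop
  have hinv : fs0.inv := fun _ => rfl
  have hb : Bnd (ts.length + 6) ts.length fs0 := ⟨by simp [fs0]; omega, by simp [fs0], by simp [fs0], by simp [fs0], by simp [fs0]⟩
  have c3 := c2'.seq (mainLoop_toks ts fs0 hinv hb)
  -- the fold, functionally
  set s2 : FS := ⟨6, 0, 0, 0, (encodeNat n).length + 1, false, false, [], [], false, (encodeNat n).reverse⟩ with hs2
  have hf : ts.foldl tokStep fs0 = formulaPass s2 F := by
    rw [hts, List.foldl_append, foldl_tokStep_hdrToks n fs0 rfl, ← foldl_tokStep_formulaToks F s2 rfl rfl]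
    congr 1
    simp [fs0, hs2]
  have hT : (formulaPass s2 F).T = ts.length := by
    rw [← hf, T_foldl_tokStep]; simp [fs0]
  obtain ⟨i1, i2, i3, i4, i5, i6, i7, i8, i9, i10⟩ := formulaPass_spec F s2 rfl rfl rfl rfl
  rcases hsp : formulaPass s2 F with ⟨A, A0, c, m, T, ic, e, lit, E, hm, nr⟩
  rw [hsp] at i1 i2 i3 i4 i5 i6 i7 i8 i9 i10 hT
  simp only [hs2] at i1 i2 i3 i4 i5 i6 i7 i8 i9 i10 hT
  simp only [Bool.false_or, List.append_nil] at i9 i10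
  simp only [Nat.zero_add] at i8
  subst i1 i2 i3 i4 i5 i6 i7 i8 i9 hT
  rw [hf, hsp, fsSt_final] at c3
  -- the post-pass
  have hA : 1 ≤ 6 + (dataWords F).length := by omega
  have c4 := c3.seq (runs_postPass kW (6 + (dataWords F).length) (F.filter fun c => c ≠ []).length ts.length n hA
    (decide ([] ∈ F)) E)
  refine ⟨hdrLog n (F.filter fun c => c ≠ []).length (6 + (dataWords F).length) ++ E, ?_, ?_, c4.of_eq rfl ?_⟩
  · rw [hdrLog_eq, wordsOf, segLog_append, show (hdrWords n (F.filter fun c => c ≠ []).length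
      (6 + (dataWords F).length)).length = 6 from rfl]
    exact (List.Perm.append (List.reverse_perm _) i10)
  · rw [List.length_append, hdrLog_eq, List.length_reverse, length_segLog, i10.length_eq, length_segLog]; rfl
  · have h1 := postCost_le kW n (F.filter fun c => c ≠ []).length (6 + (dataWords F).length) ts.length
      (by have := length_dataWords_le F; rw [hts, List.length_append]; omega)
      (by have := length_filter_le_formulaToks F; rw [hts, List.length_append]; omega)
    simp only [frontCost, Nat.add_comm ts.length 6]
    omega

end Literature.Computability.Cryptography.KCNFToRAM
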